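import Summits.AtomisticToContinuum.HydrodynamicLimit.Theorems.OneSphereInfluenceAssemblyScore
import Mathlib.Analysis.Calculus.ParametricIntegral
import HarnessLib

/-!
# Assembly of route `OneSphereInfluence` (stmt-AtomisticToContinuum-14700): differentiating the
# canonical weight under the integral sign

Helper file for the assembly item `…Theses.OneSphereInfluence.Assembly`. For a jointly smooth path
`κ ∈ [0,1] ↦ (a_κ, u₀κ, θ₀κ)` of local-Gibbs profiles (`a_κ, θ₀κ > 0`), reduced diameter `σ` and
particle number `N + 1`, the unnormalised canonical weight
`w_κ(z) = 𝟙_{D_ε}(z) ∏ᵢ f_κ(zᵢ)` on phase space `(𝕋³ × ℝ³)^{N+1}` satisfies, for every measurable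
observable `F` with `|F(z)| ≤ K (1 + ∑ᵢ |vᵢ|²)` a.e. on the hard-sphere domain:

* `κ ↦ ∫ w_κ F dz` is differentiable at every interior `κ ∈ (0,1)` with derivative
  `∫ w_κ S_κ F dz`, `S_κ(z) = ∑ᵢ s_κ(zᵢ)` the total score
  (`hasDerivAt_integral_weight_mul`), and continuous on `[0,1]`
  (`continuousOn_integral_weight_mul`);

by dominated differentiation (`hasDerivAt_integral_of_dominated_loc_of_deriv_le`): the
`κ`-derivative of the weight is `w_κ S_κ` (`OneSphereInfluenceAssemblyScore`), and
`|S_κ| |w_κ| |F| ≤ A K (∑ᵢ(1+|vᵢ|²))² Bⁿ ∏ᵢ e^{-c|vᵢ|²} ≤ const ∏ᵢ e^{-(c/2)|vᵢ|²}`, an integrable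
product. The normalisation (quotient rule, covariance form) is done in
`OneSphereInfluenceAssemblyScoreCovariance.lean`. Folklore; no definitions.
-/

noncomputable section

open MeasureTheory Filter Set Topology Real
open scoped InnerProductSpace

namespace Summit.AtomisticToContinuum.HydrodynamicLimit.Theorems.OneSphereInfluenceAssembly

open Literature.Analysis.FluidPDE Literature.MathematicalPhysics.KineticTheory

/-! ## Integrable Gaussian products on phase space -/

/-- `v ↦ exp(-b|v|²)` is integrable on `ℝ³` for `b > 0` (it is a multiple of a Maxwellian).
[folklore] -/
theorem integrable_exp_neg_mul_norm_sq {b : ℝ} (hb : 0 < b) :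
    Integrable (fun v : V3 => Real.exp (-b * ‖v‖ ^ 2)) := by
  have hθ : 0 < 1 / (2 * b) := by positivity
  have h := (integrable_localMaxwellian hθ (0 : V3)).const_mul ((2 * π * (1 / (2 * b))) ^ ((3 : ℝ) / 2))
  refine h.congr (Eventually.of_forall fun v => ?_)
  simp only
  rw [localMaxwellian, finrank_euclideanSpace, Fintype.card_fin, sub_zero, one_mul, ← mul_assoc,
    ← Real.rpow_add (by positivity)]
  norm_num
  field_simp

/-- `(x, v) ↦ exp(-b|v|²)` is integrable on the one-particle phase space `𝕋³ × ℝ³`. [folklore] -/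
theorem integrable_exp_neg_mul_norm_sq_snd {b : ℝ} (hb : 0 < b) :
    Integrable (fun y : T3 × V3 => Real.exp (-b * ‖y.2‖ ^ 2)) := by
  have h1 : Integrable (fun _ : T3 => (1 : ℝ)) := continuous_const.integrable_unitAddTorus
  have h := h1.mul_prod (integrable_exp_neg_mul_norm_sq hb)
  rw [← Measure.volume_eq_prod] at h
  simpa only [one_mul] using h

/-- The Gaussian product `z ↦ ∏ᵢ exp(-b|vᵢ|²)` is integrable on `(𝕋³ × ℝ³)ⁿ`. [folklore] -/
theorem integrable_prod_exp_neg_mul_norm_sq {b : ℝ} (hb : 0 < b) (n : ℕ) :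
    Integrable (fun z : Config n (Fin 3) T3 => ∏ i, Real.exp (-b * ‖(z i).2‖ ^ 2)) := by
  have hsf : ∀ i : Fin n, SigmaFinite ((fun _ : Fin n => (volume : Measure (T3 × V3))) i) :=
    fun _ => inferInstance
  have h := @Integrable.fintype_prod ℝ (Fin n) _ _ (T3 × V3) (fun _ y => Real.exp (-b * ‖y.2‖ ^ 2)) _
    (fun _ => volume) hsf (fun _ => integrable_exp_neg_mul_norm_sq_snd hb)
  rwa [← volume_pi] at h

/-- `t² ≤ (2/ε²) exp(ε t)` for `t ≥ 0`, `ε > 0`. [folklore] -/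
theorem sq_le_mul_exp {ε t : ℝ} (hε : 0 < ε) (ht : 0 ≤ t) : t ^ 2 ≤ 2 / ε ^ 2 * Real.exp (ε * t) := by
  have h := Real.pow_div_factorial_le_exp (ε * t) (by positivity) 2
  simp only [Nat.factorial, Nat.succ_eq_add_one, Nat.reduceAdd, zero_add, mul_one,
    Nat.cast_ofNat] at h
  rw [div_mul_eq_mul_div, le_div_iff₀ (by positivity)]
  nlinarith [h]

/-- **Polynomial times Gaussian is a wider Gaussian.** With `T = ∑ᵢ (1 + |vᵢ|²)` and `c > 0`:
`T² ∏ᵢ e^{-c|vᵢ|²} ≤ (8/c²) e^{(c/2) n} ∏ᵢ e^{-(c/2)|vᵢ|²}`. [folklore] -/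
theorem sq_sum_mul_prod_exp_le {c : ℝ} (hc : 0 < c) {n : ℕ} (z : Config n (Fin 3) T3) :
    (∑ i, (1 + ‖(z i).2‖ ^ 2)) ^ 2 * ∏ i, Real.exp (-c * ‖(z i).2‖ ^ 2) ≤
      8 / c ^ 2 * Real.exp (c / 2 * n) * ∏ i, Real.exp (-(c / 2) * ‖(z i).2‖ ^ 2) := by
  set T := ∑ i, (1 + ‖(z i).2‖ ^ 2) with hT
  have hT0 : 0 ≤ T := Finset.sum_nonneg fun i _ => by positivity
  have h1 : T ^ 2 ≤ 2 / (c / 2) ^ 2 * Real.exp (c / 2 * T) := sq_le_mul_exp (by positivity) hT0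
  have h2 : Real.exp (c / 2 * T) = Real.exp (c / 2 * n) * ∏ i, Real.exp (c / 2 * ‖(z i).2‖ ^ 2) := by
    rw [hT, Finset.mul_sum, Real.exp_sum]
    have he : ∀ i : Fin n, Real.exp (c / 2 * (1 + ‖(z i).2‖ ^ 2)) =
        Real.exp (c / 2) * Real.exp (c / 2 * ‖(z i).2‖ ^ 2) := fun i => by
      rw [← Real.exp_add]; ring_nf
    simp_rw [he]
    rw [Finset.prod_mul_distrib, Finset.prod_const, Finset.card_univ, Fintype.card_fin,
      ← Real.exp_nat_mul]
    ring_nf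
  have h3 : (∏ i, Real.exp (c / 2 * ‖(z i).2‖ ^ 2)) * ∏ i, Real.exp (-c * ‖(z i).2‖ ^ 2) =
      ∏ i, Real.exp (-(c / 2) * ‖(z i).2‖ ^ 2) := by
    rw [← Finset.prod_mul_distrib]
    refine Finset.prod_congr rfl fun i _ => ?_
    rw [← Real.exp_add]
    ring_nf
  have hP0 : 0 ≤ ∏ i, Real.exp (-c * ‖(z i).2‖ ^ 2) := Finset.prod_nonneg fun i _ => (Real.exp_nonneg _)
  calc T ^ 2 * ∏ i, Real.exp (-c * ‖(z i).2‖ ^ 2)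
      ≤ (2 / (c / 2) ^ 2 * Real.exp (c / 2 * T)) * ∏ i, Real.exp (-c * ‖(z i).2‖ ^ 2) :=
        mul_le_mul_of_nonneg_right h1 hP0
    _ = 8 / c ^ 2 * Real.exp (c / 2 * n) * ∏ i, Real.exp (-(c / 2) * ‖(z i).2‖ ^ 2) := by
        rw [h2, mul_assoc, mul_assoc, h3]
        field_simp
        ring

/-! ## The canonical weight along a smooth path of profiles -/

section Path

variable {a θ₀ : ℝ → T3 → ℝ} {u₀ : ℝ → T3 → V3}
  (ha : Literature.Analysis.FunctionSpaces.Torus.IsSmoothSpaceTimeOn (Icc 0 1) a)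
  (hθ : Literature.Analysis.FunctionSpaces.Torus.IsSmoothSpaceTimeOn (Icc 0 1) θ₀)
  (hu : Literature.Analysis.FunctionSpaces.Torus.IsSmoothSpaceTimeOn (Icc 0 1) u₀)
  (ha0 : ∀ κ ∈ Icc (0 : ℝ) 1, ∀ x, 0 < a κ x) (hθ0 : ∀ κ ∈ Icc (0 : ℝ) 1, ∀ x, 0 < θ₀ κ x)

/-- The profile along the path. -/
local notation "prof[" κ "]" => localGibbsProfile (a κ) (u₀ κ) (θ₀ κ)
/-- The one-particle score along the path. -/
local notation "sc[" κ ", " y "]" =>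
  derivWithin (fun κ' => Real.log (localGibbsProfile (a κ') (u₀ κ') (θ₀ κ') y)) (Icc 0 1) κ

include ha0 hθ0 in
/-- Along the path the tensor power of the profile is the exponential of the sum of the logs.
[folklore] -/
theorem tensorPow_eq_exp_sum {κ : ℝ} (hκ : κ ∈ Icc (0 : ℝ) 1) {n : ℕ} (z : Config n (Fin 3) T3) :
    tensorPow n (prof[κ]) z = Real.exp (∑ i, Real.log (prof[κ] (z i))) := by
  rw [Real.exp_sum, tensorPow]
  exact Finset.prod_congr rfl fun i _ =>
    (Real.exp_log (localGibbsProfile_pos' (u₀ κ) (ha0 κ hκ (z i).1) (hθ0 κ hκ (z i).1))).symm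

include ha hθ hu ha0 hθ0 in
/-- **The `κ`-derivative of the tensor power is the tensor power times the total score**, within
`[0,1]`. [folklore] -/
theorem hasDerivWithinAt_tensorPow {κ : ℝ} (hκ : κ ∈ Icc (0 : ℝ) 1) {n : ℕ} (z : Config n (Fin 3) T3) :
    HasDerivWithinAt (fun κ' => tensorPow n (prof[κ']) z)
      (tensorPow n (prof[κ]) z * ∑ i, sc[κ, z i]) (Icc 0 1) κ := by
  have hsum : HasDerivWithinAt (fun κ' => ∑ i, Real.log (prof[κ'] (z i))) (∑ i, sc[κ, z i]) (Icc 0 1) κ := by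
    refine HasDerivWithinAt.fun_sum fun i _ => ?_
    have h := hasDerivWithinAt_log_localGibbsProfile ha hθ hu ha0 hθ0 hκ (z i)
    rwa [← derivWithin_log_localGibbsProfile ha hθ hu ha0 hθ0 hκ (z i)] at h
  refine (hsum.exp.congr (fun κ' hκ' => tensorPow_eq_exp_sum ha0 hθ0 hκ' z)
    (tensorPow_eq_exp_sum ha0 hθ0 hκ z)).congr_deriv ?_
  rw [← tensorPow_eq_exp_sum ha0 hθ0 hκ z]

include ha hθ hu ha0 hθ0 in
/-- The tensor power is continuous in `κ ∈ [0,1]`. [folklore] -/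
theorem continuousOn_tensorPow {n : ℕ} (z : Config n (Fin 3) T3) :
    ContinuousOn (fun κ' => tensorPow n (prof[κ']) z) (Icc 0 1) := by
  unfold tensorPow
  exact continuousOn_finsetProd _ fun i _ => continuousOn_localGibbsProfile ha hθ hu ha0 hθ0 (z i)

include ha hθ hu hθ0 in
/-- The tensor power is continuous in the configuration, for `κ ∈ [0,1]`. [folklore] -/
theorem continuous_tensorPow {κ : ℝ} (hκ : κ ∈ Icc (0 : ℝ) 1) (n : ℕ) :
    Continuous fun z : Config n (Fin 3) T3 => tensorPow n (prof[κ]) z := by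
  unfold tensorPow
  exact continuous_finsetProd _ fun i _ =>
    (continuous_localGibbsProfile ha hθ hu hθ0 hκ).comp (continuous_apply i)

include ha hθ hu ha0 hθ0 in
/-- The total score `S_κ(z) = ∑ᵢ s_κ(zᵢ)` is continuous in the configuration, for `κ ∈ [0,1]`.
[folklore] -/
theorem continuous_scoreSum {κ : ℝ} (hκ : κ ∈ Icc (0 : ℝ) 1) (n : ℕ) :
    Continuous fun z : Config n (Fin 3) T3 => ∑ i, sc[κ, z i] := by
  refine continuous_finsetSum _ fun i _ => ?_
  have h := (continuous_score ha hθ hu ha0 hθ0 hκ).comp (continuous_apply (A := fun _ : Fin n => T3 × V3) i)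
  refine h.congr fun z => ?_
  simp only [Function.comp_apply]
  exact (derivWithin_log_localGibbsProfile ha hθ hu ha0 hθ0 hκ (z i)).symm

include ha hθ hu ha0 hθ0 in
/-- **Uniform domination of the weight and of its `κ`-derivative.** For an observable bound
`K ≥ 0` there is an integrable `bound` on phase space such that for all `κ ∈ [0,1]` and all `z`
with `|F z| ≤ K (1 + ∑ᵢ |vᵢ|²)`: `|∏ f_κ(zᵢ) F(z)| ≤ bound z` and
`|∏ f_κ(zᵢ) (∑ s_κ(zᵢ)) F(z)| ≤ bound z`. [folklore] -/
theorem exists_integrable_bound (n : ℕ) {K : ℝ} (hK : 0 ≤ K) :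
    ∃ bound : Config n (Fin 3) T3 → ℝ, Integrable bound ∧
      ∀ κ ∈ Icc (0 : ℝ) 1, ∀ (z : Config n (Fin 3) T3) (Fz : ℝ),
        |Fz| ≤ K * (1 + ∑ i, ‖(z i).2‖ ^ 2) →
          |tensorPow n (prof[κ]) z * Fz| ≤ bound z ∧
          |tensorPow n (prof[κ]) z * ((∑ i, sc[κ, z i]) * Fz)| ≤ bound z := by
  obtain ⟨A, hA0, hA⟩ := exists_abs_score_le ha hθ hu ha0 hθ0
  obtain ⟨B, c, hB0, hc, hBc⟩ := exists_localGibbsProfile_le_exp ha hθ hu ha0 hθ0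
  set M : ℝ := max A 1 * K * B ^ n * (8 / c ^ 2 * Real.exp (c / 2 * n)) with hM
  have hM0 : 0 ≤ M := by rw [hM]; positivity
  refine ⟨fun z => (M + K) * ∏ i, Real.exp (-(c / 2) * ‖(z i).2‖ ^ 2),
    (integrable_prod_exp_neg_mul_norm_sq (half_pos hc) n).const_mul (M + K), fun κ hκ z Fz hFz => ?_⟩
  have hP0 : 0 ≤ ∏ i, Real.exp (-(c / 2) * ‖(z i).2‖ ^ 2) :=
    Finset.prod_nonneg fun i _ => Real.exp_nonneg _
  set T := ∑ i, (1 + ‖(z i).2‖ ^ 2) with hT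
  have hTnn : 0 ≤ T := Finset.sum_nonneg fun i _ => by positivity
  -- the tensor power is dominated by a Gaussian product
  have hW0 : 0 ≤ tensorPow n (prof[κ]) z := Finset.prod_nonneg fun i _ =>
    (localGibbsProfile_pos' (u₀ κ) (ha0 κ hκ (z i).1) (hθ0 κ hκ (z i).1)).le
  have hWle : tensorPow n (prof[κ]) z ≤ B ^ n * ∏ i, Real.exp (-c * ‖(z i).2‖ ^ 2) := by
    calc tensorPow n (prof[κ]) z ≤ ∏ i, (B * Real.exp (-c * ‖(z i).2‖ ^ 2)) :=
          Finset.prod_le_prod (fun i _ =>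
            (localGibbsProfile_pos' (u₀ κ) (ha0 κ hκ (z i).1) (hθ0 κ hκ (z i).1)).le) fun i _ => hBc κ hκ (z i)
      _ = B ^ n * ∏ i, Real.exp (-c * ‖(z i).2‖ ^ 2) := by
          rw [Finset.prod_mul_distrib, Finset.prod_const, Finset.card_univ, Fintype.card_fin]
  -- the score sum is dominated by `A T`
  have hSle : |∑ i, sc[κ, z i]| ≤ A * T := by
    rw [hT, Finset.mul_sum]
    exact (Finset.abs_sum_le_sum_abs _ _).trans (Finset.sum_le_sum fun i _ => hA κ hκ (z i))
  -- the key estimate `W · (max A 1) T · K T ≤ M ∏ e^{-(c/2)|vᵢ|²}`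
  have hkey : |tensorPow n (prof[κ]) z| * (max A 1 * T) * (K * T) ≤
      (M + K) * ∏ i, Real.exp (-(c / 2) * ‖(z i).2‖ ^ 2) := by
    rw [abs_of_nonneg hW0]
    have hg := sq_sum_mul_prod_exp_le hc z
    rw [← hT] at hg
    calc tensorPow n (prof[κ]) z * (max A 1 * T) * (K * T)
        = max A 1 * K * (T ^ 2 * tensorPow n (prof[κ]) z) := by ring
      _ ≤ max A 1 * K * (T ^ 2 * (B ^ n * ∏ i, Real.exp (-c * ‖(z i).2‖ ^ 2))) := by
          refine mul_le_mul_of_nonneg_left (mul_le_mul_of_nonneg_left hWle (sq_nonneg _)) (by positivity)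
      _ = max A 1 * K * B ^ n * (T ^ 2 * ∏ i, Real.exp (-c * ‖(z i).2‖ ^ 2)) := by ring
      _ ≤ max A 1 * K * B ^ n * (8 / c ^ 2 * Real.exp (c / 2 * n) * ∏ i, Real.exp (-(c / 2) * ‖(z i).2‖ ^ 2)) :=
          mul_le_mul_of_nonneg_left hg (by positivity)
      _ = M * ∏ i, Real.exp (-(c / 2) * ‖(z i).2‖ ^ 2) := by rw [hM]; ring
      _ ≤ (M + K) * ∏ i, Real.exp (-(c / 2) * ‖(z i).2‖ ^ 2) :=
          mul_le_mul_of_nonneg_right (by linarith) hP0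
  rcases Nat.eq_zero_or_pos n with hn | hn
  · -- no particles: everything is explicit
    subst hn
    have hF0 : |Fz| ≤ K := by simpa using hFz
    simp only [tensorPow, Finset.univ_eq_empty, Finset.prod_empty, Finset.sum_empty, one_mul,
      zero_mul, abs_zero, mul_one]
    exact ⟨hF0.trans (by linarith), by linarith⟩
  have hT1 : (1 + ∑ i, ‖(z i).2‖ ^ 2) ≤ T := by
    rw [hT, Finset.sum_add_distrib]
    simp only [Finset.sum_const, Finset.card_univ, Fintype.card_fin, nsmul_eq_mul, mul_one]
    have : (1 : ℝ) ≤ n := by exact_mod_cast hn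
    linarith
  have hFT : |Fz| ≤ K * T := hFz.trans (mul_le_mul_of_nonneg_left hT1 hK)
  have hT1' : 1 ≤ T := le_trans (by simp only [le_add_iff_nonneg_right]; positivity) hT1
  constructor
  · rw [abs_mul]
    calc |tensorPow n (prof[κ]) z| * |Fz| ≤ |tensorPow n (prof[κ]) z| * (max A 1 * T) * (K * T) := by
          rw [mul_assoc]
          refine mul_le_mul_of_nonneg_left ?_ (abs_nonneg _)
          calc |Fz| ≤ 1 * (K * T) := by rw [one_mul]; exact hFT
            _ ≤ (max A 1 * T) * (K * T) := by
                refine mul_le_mul_of_nonneg_right ?_ (by positivity)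
                nlinarith [le_max_right A 1]
      _ ≤ _ := hkey
  · rw [abs_mul, abs_mul]
    calc |tensorPow n (prof[κ]) z| * (|∑ i, sc[κ, z i]| * |Fz|)
        ≤ |tensorPow n (prof[κ]) z| * (max A 1 * T) * (K * T) := by
          rw [mul_assoc]
          refine mul_le_mul_of_nonneg_left ?_ (abs_nonneg _)
          exact mul_le_mul (hSle.trans (mul_le_mul_of_nonneg_right (le_max_left _ _) hTnn)) hFT
            (abs_nonneg _) (by positivity)
      _ ≤ _ := hkey

/-! ## Dominated differentiation of `κ ↦ ∫ 𝟙_D ∏ f_κ(zᵢ) F(z) dz` -/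

/-- The hard-sphere domain of `N + 1` spheres of reduced diameter `σ`. -/
local notation "Dom[" σ ", " N "]" =>
  hardSphereDomain (Torus.geometry (Fin 3)) (N + 1) (hsDiameter σ N)

/-- The hard-sphere domain is measurable. [folklore] -/
theorem measurableSet_dom (σ : ℝ) (N : ℕ) : MeasurableSet (Dom[σ, N]) :=
  measurableSet_hardSphereDomain _ Torus.measurable_geometry_sepVec _ _

include ha hθ hu hθ0 in
/-- The canonical weight `𝟙_D ∏ f_κ(zᵢ)` is measurable in the configuration (`κ ∈ [0,1]`).
[folklore] -/
theorem measurable_weight (σ : ℝ) (N : ℕ) {κ : ℝ} (hκ : κ ∈ Icc (0 : ℝ) 1) :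
    Measurable fun z : Config (N + 1) (Fin 3) T3 => (Dom[σ, N]).indicator (tensorPow (N + 1) (prof[κ])) z :=
  (continuous_tensorPow ha hθ hu hθ0 hκ (N + 1)).measurable.indicator (measurableSet_dom σ N)

include ha hθ hu ha0 hθ0 in
/-- **Integrability of the weighted observable** `𝟙_D ∏ f_κ(zᵢ) F(z)` and of its `κ`-derivative
`𝟙_D ∏ f_κ(zᵢ) S_κ(z) F(z)`, for `κ ∈ [0,1]` and an energy-dominated measurable `F`. [folklore] -/
theorem integrable_weight_mul (σ : ℝ) (N : ℕ) {F : Config (N + 1) (Fin 3) T3 → ℝ}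
    (hFm : Measurable F) {K : ℝ} (hK : 0 ≤ K)
    (hFb : ∀ᵐ z ∂(volume : Measure (Config (N + 1) (Fin 3) T3)),
      z ∈ Dom[σ, N] → |F z| ≤ K * (1 + ∑ i, ‖(z i).2‖ ^ 2))
    {κ : ℝ} (hκ : κ ∈ Icc (0 : ℝ) 1) :
    Integrable (fun z => (Dom[σ, N]).indicator (tensorPow (N + 1) (prof[κ])) z * F z) ∧
    Integrable (fun z => (Dom[σ, N]).indicator (tensorPow (N + 1) (prof[κ])) z *
      ((∑ i, sc[κ, z i]) * F z)) := by
  obtain ⟨bound, hbi, hb⟩ := exists_integrable_bound ha hθ hu ha0 hθ0 (N + 1) hK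
  have hWm := measurable_weight ha hθ hu hθ0 σ N hκ
  have hSm := (continuous_scoreSum ha hθ hu ha0 hθ0 hκ (N + 1)).measurable
  constructor
  · refine hbi.mono' (hWm.mul hFm).aestronglyMeasurable ?_
    filter_upwards [hFb] with z hz
    rw [Real.norm_eq_abs]
    by_cases hzD : z ∈ Dom[σ, N]
    · rw [indicator_of_mem hzD]
      exact (hb κ hκ z (F z) (hz hzD)).1
    · rw [indicator_of_notMem hzD, zero_mul, abs_zero]
      have h0 := (hb κ hκ z 0 (by rw [abs_zero]; positivity)).1
      exact (abs_nonneg _).trans h0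
  · refine hbi.mono' (hWm.mul (hSm.mul hFm)).aestronglyMeasurable ?_
    filter_upwards [hFb] with z hz
    rw [Real.norm_eq_abs]
    by_cases hzD : z ∈ Dom[σ, N]
    · rw [indicator_of_mem hzD]
      exact (hb κ hκ z (F z) (hz hzD)).2
    · rw [indicator_of_notMem hzD, zero_mul, abs_zero]
      have h0 := (hb κ hκ z 0 (by rw [abs_zero]; positivity)).1
      exact (abs_nonneg _).trans h0

include ha hθ hu ha0 hθ0 in
/-- **Differentiation under the integral sign (unnormalised score identity).** For an
energy-dominated measurable observable `F` and an interior `κ ∈ (0,1)`,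
`d/dκ ∫ 𝟙_D(z) ∏ᵢ f_κ(zᵢ) F(z) dz = ∫ 𝟙_D(z) ∏ᵢ f_κ(zᵢ) S_κ(z) F(z) dz`, `S_κ(z) = ∑ᵢ s_κ(zᵢ)`
(`hasDerivAt_integral_of_dominated_loc_of_deriv_le` with the Gaussian-product bound of
`exists_integrable_bound`). [folklore] -/
theorem hasDerivAt_integral_weight_mul (σ : ℝ) (N : ℕ) {F : Config (N + 1) (Fin 3) T3 → ℝ}
    (hFm : Measurable F) {K : ℝ} (hK : 0 ≤ K)
    (hFb : ∀ᵐ z ∂(volume : Measure (Config (N + 1) (Fin 3) T3)),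
      z ∈ Dom[σ, N] → |F z| ≤ K * (1 + ∑ i, ‖(z i).2‖ ^ 2))
    {κ : ℝ} (hκ : κ ∈ Ioo (0 : ℝ) 1) :
    HasDerivAt (fun κ' => ∫ z, (Dom[σ, N]).indicator (tensorPow (N + 1) (prof[κ'])) z * F z)
      (∫ z, (Dom[σ, N]).indicator (tensorPow (N + 1) (prof[κ])) z * ((∑ i, sc[κ, z i]) * F z)) κ := by
  obtain ⟨bound, hbi, hb⟩ := exists_integrable_bound ha hθ hu ha0 hθ0 (N + 1) hK
  have hIoo : Ioo (0 : ℝ) 1 ∈ 𝓝 κ := Ioo_mem_nhds hκ.1 hκ.2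
  have hsub : Ioo (0 : ℝ) 1 ⊆ Icc 0 1 := Ioo_subset_Icc_self
  have hκ' : κ ∈ Icc (0 : ℝ) 1 := hsub hκ
  have hF_meas : ∀ᶠ κ' in 𝓝 κ, AEStronglyMeasurable
      (fun z => (Dom[σ, N]).indicator (tensorPow (N + 1) (prof[κ'])) z * F z) volume :=
    eventually_of_mem hIoo fun κ' hκ' =>
      ((measurable_weight ha hθ hu hθ0 σ N (hsub hκ')).mul hFm).aestronglyMeasurable
  have hF_int := (integrable_weight_mul ha hθ hu ha0 hθ0 σ N hFm hK hFb hκ').1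
  have hF'_meas : AEStronglyMeasurable (fun z => (Dom[σ, N]).indicator (tensorPow (N + 1) (prof[κ])) z *
      ((∑ i, sc[κ, z i]) * F z)) volume :=
    ((measurable_weight ha hθ hu hθ0 σ N hκ').mul
      ((continuous_scoreSum ha hθ hu ha0 hθ0 hκ' (N + 1)).measurable.mul hFm)).aestronglyMeasurable
  have h_bound : ∀ᵐ z ∂(volume : Measure (Config (N + 1) (Fin 3) T3)), ∀ κ' ∈ Ioo (0 : ℝ) 1,
      ‖(Dom[σ, N]).indicator (tensorPow (N + 1) (prof[κ'])) z * ((∑ i, sc[κ', z i]) * F z)‖ ≤ bound z := by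
    filter_upwards [hFb] with z hz κ' hκ'
    rw [Real.norm_eq_abs]
    by_cases hzD : z ∈ Dom[σ, N]
    · rw [indicator_of_mem hzD]
      exact (hb κ' (hsub hκ') z (F z) (hz hzD)).2
    · rw [indicator_of_notMem hzD, zero_mul, abs_zero]
      exact (abs_nonneg _).trans (hb κ' (hsub hκ') z 0 (by rw [abs_zero]; positivity)).1
  have h_diff : ∀ᵐ z ∂(volume : Measure (Config (N + 1) (Fin 3) T3)), ∀ κ' ∈ Ioo (0 : ℝ) 1,
      HasDerivAt (fun κ'' => (Dom[σ, N]).indicator (tensorPow (N + 1) (prof[κ''])) z * F z)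
        ((Dom[σ, N]).indicator (tensorPow (N + 1) (prof[κ'])) z * ((∑ i, sc[κ', z i]) * F z)) κ' := by
    refine Eventually.of_forall fun z κ' hκ' => ?_
    by_cases hzD : z ∈ Dom[σ, N]
    · simp only [indicator_of_mem hzD]
      have h := ((hasDerivWithinAt_tensorPow ha hθ hu ha0 hθ0 (hsub hκ') z).hasDerivAt
        (Icc_mem_nhds hκ'.1 hκ'.2)).mul_const (F z)
      exact h.congr_deriv (by ring)
    · simp only [indicator_of_notMem hzD, zero_mul]
      exact hasDerivAt_const _ _
  exact (hasDerivAt_integral_of_dominated_loc_of_deriv_le hIoo hF_meas hF_int hF'_meas h_bound hbi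
    h_diff).2

include ha hθ hu ha0 hθ0 in
/-- **Continuity on `[0,1]`** of `κ ↦ ∫ 𝟙_D(z) ∏ᵢ f_κ(zᵢ) F(z) dz` (dominated convergence).
[folklore] -/
theorem continuousOn_integral_weight_mul (σ : ℝ) (N : ℕ) {F : Config (N + 1) (Fin 3) T3 → ℝ}
    (hFm : Measurable F) {K : ℝ} (hK : 0 ≤ K)
    (hFb : ∀ᵐ z ∂(volume : Measure (Config (N + 1) (Fin 3) T3)),
      z ∈ Dom[σ, N] → |F z| ≤ K * (1 + ∑ i, ‖(z i).2‖ ^ 2)) :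
    ContinuousOn (fun κ' => ∫ z, (Dom[σ, N]).indicator (tensorPow (N + 1) (prof[κ'])) z * F z) (Icc 0 1) := by
  obtain ⟨bound, hbi, hb⟩ := exists_integrable_bound ha hθ hu ha0 hθ0 (N + 1) hK
  refine continuousOn_of_dominated (fun κ hκ =>
    ((measurable_weight ha hθ hu hθ0 σ N hκ).mul hFm).aestronglyMeasurable) (fun κ hκ => ?_) hbi ?_
  · filter_upwards [hFb] with z hz
    rw [Real.norm_eq_abs]
    by_cases hzD : z ∈ Dom[σ, N]
    · rw [indicator_of_mem hzD]
      exact (hb κ hκ z (F z) (hz hzD)).1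
    · rw [indicator_of_notMem hzD, zero_mul, abs_zero]
      exact (abs_nonneg _).trans (hb κ hκ z 0 (by rw [abs_zero]; positivity)).1
  · refine Eventually.of_forall fun z => ?_
    by_cases hzD : z ∈ Dom[σ, N]
    · simp only [indicator_of_mem hzD]
      exact (continuousOn_tensorPow ha hθ hu ha0 hθ0 z).mul continuousOn_const
    · simp only [indicator_of_notMem hzD, zero_mul]
      exact continuousOn_const

end Path

end Summit.AtomisticToContinuum.HydrodynamicLimit.Theorems.OneSphereInfluenceAssembly

end
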